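import Literature.Computability.AlgebraicComplexity.BorderRankCWKoszulRanks
import Literature.Computability.AlgebraicComplexity.KoszulFlatteningKronecker
import HarnessLib

/-!
# Border rank of Kronecker powers of `T_{cw,q}`: the ingredients of CGLV 2022, Thm. 1.2 (iii)

Topic: `Literature/Computability/AlgebraicComplexity`. Sibling of `BorderRankCW.lean` (which vendors
the named fact `CGLV2022_thm12_power` = Conner–Gesmundo–Landsberg–Ventura 2022, Thm. 1.2 (iii)) for
the fact item `provefact … CGLV2022_thm12_power`: it DECOMPOSES that fact along the source's proof
(arXiv:1909.04785v2 = journal numbering: Prop. 3.2, Thms. 3.3–3.4, Cor. 3.5), using the proved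
machinery of `KoszulFlatteningKronecker.lean` (`CGLV2022_prop32`), `KoszulFlatteningBorderRank.lean`
(the Koszul bound for `algBorderRank`) and the sibling `BorderRankCWKoszulRanks.lean` (the
companion decomposition of the SQUARE part of Thm. 1.2: the projection `cglvPhi2 = φ₂` of Thm. 3.3,
the named rank facts `CGLV2022_thm33_koszulRank` (`q ≥ 4`) and `CGLV2022_koszulRank_sq_three`
(`q = 3`, rank `≥ 150`), which are reused here, not restated).

## Content

* `cwCovector`, `isUnit_contractFirst_cwCovector`, `isOneAGeneric_kroneckerPow_cwTensor` — PROVED: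
  `T_{cw,q}(a₀^* + a₁^*) = ∑_{j≥1} b_j ⊗ c_j + b₀ ⊗ c₁ + b₁ ⊗ c₀` is invertible (`q ≥ 1`), so every
  `T_{cw,q}^{⊠N}` is `1_A`-generic (the remark in the proof of Cor. 3.5).
* `cglvPhi3 K q` — the restriction `φ₃ : A^{⊗3} → ℂ⁵` (proof of Thm. 3.4), transcribed as printed
  (matrix on the basis `a_{ijk}`; `φ₂` is `cglvPhi2` of the sibling file).
* Named facts (the source's rank computations, `def … : Prop`):
  `CGLV2022_thm33_koszulRank_q4` (the base case `q = 4` of Thm. 3.3's rank: `= 72`),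
  `CGLV2022_thm34_koszulRank` (`q ≥ 5`: `rank((φ₃T_{cw,q}^{⊠3})^{∧2}) = 6(q+2)³`),
  `CGLV2022_thm12_power_q2` (the clause `q = 2` of Thm. 1.2 (iii)), `CGLV2022_cor35` (Cor. 3.5 as
  printed).
* PROVED assemblies: `CGLV2022_thm12_power_ge5_of_koszulRank`, `…_four_…`, `…_three_…`,
  `CGLV2022_cor35_of_koszulRank : thm33_q4 → thm34 → Cor. 3.5`,
  `CGLV2022_thm12_power_of_koszulRank : thm34 → thm33_q4 → koszulRank_sq_three → power_q2 → CGLV2022_thm12_power`,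
  and the projections `CGLV2022_thm12_power.cor35`, `.q2`, `CGLV2022_thm33_koszulRank.q4`.
  A kernel certificate discharging `CGLV2022_thm33_koszulRank_q4` is filed separately
  (`BorderRankCWKoszulQ4.lean`).

## What was checked, and a caveat on the clause `q = 2`

The transcriptions were checked by exact modular rank computations when vendoring (item census):
`φ₂` gives ranks `72, 98, 128, 162, 200 = 2(q+2)²` for `q = 4,…,8`; `φ₃` gives `2058 = 6·7³` for
`q = 5` and `3072 = 6·8³` for `q = 6`; a generic restriction `ℂ^{16} → ℂ⁵` gives `150` for `q = 3`.  For `q = 2` the source's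
route does NOT apply: Cor. 3.5 (the proved form of Thm. 1.2 (iii)) covers `q ≥ 4` only, and
Prop. 3.2 would need a `p = 2` flattening of `T_{cw,2}^{⊠2}` of rank `90`, while the maximal rank is
`85` (bound `⌈85/6⌉ = 15` of Thm. 1.2 (i)).  Direct `p = 2` flattenings of `T_{cw,2}^{⊠N}` have rank
`10·3^N - 5` for `N = 2,…,5` (so the clause holds for `N ≤ 5`), but no proof of the clause for all
`N` is known to us; it is isolated as the named fact `CGLV2022_thm12_power_q2` with this caveat, and
`CGLV2022_cor35` records the part the source proves.  Thm. 1.2 (iii) also prints `T_{cw,2}^{⊠3}`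
where `T_{cw,2}^{⊠N}` is meant (as in `BorderRankCW.lean`).

## Design choices

* All flattening ranks are stated for the tree's `koszulFlattening p M.mulVecLin t` (rows
  `Λ^{p+1} × C`, columns `Λ^p × B^*`, `A' = K^{2p+1}`), as in the sibling file; Kronecker powers are
  `kroneckerPow` on index types `Fin N → Fin (q+1)` (`a_{ijk} ↦ x` with `x 0 = i`, `x 1 = j`, `x 2 = k`).
* `cglvPhi3` compares natural-number values of indices (no `Fin` numerals mod `q + 1`); it is
  defined for every `q` and every commutative ring but only used for `q ≥ 5` over `ℂ`.
* The inequalities are kept in product form over `ℕ`; `C(2,1) = 2`, `C(4,2) = 6` are evaluated by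
  `decide`.

## References

* A. Conner, F. Gesmundo, J. M. Landsberg, E. Ventura, *Rank and border rank of Kronecker powers of
  tensors and Strassen's laser method*, comput. complexity 31 (2022), Thm. 1.2, §3 (Prop. 3.2,
  Thm. 3.3 and its proof incl. `φ₂`, Thm. 3.4 and its proof incl. `φ₃`, Cor. 3.5),
  doi:10.1007/s00037-021-00217-y, arXiv:1909.04785v2. [ConnerGesmundoLandsbergVentura2022]
* A. Conner, H. Huang, J. M. Landsberg, *Bad and good news for Strassen's laser method: border rank
  of perm₃ and strict submultiplicativity*, Found. Comput. Math. (2022), arXiv:2009.11391 (Thm. 1.1: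
  `bR(T_{cw,2}^{⊠2}) = 16`). [ConnerHuangLandsberg2020]
-/

noncomputable section

open scoped BigOperators Polynomial
open Module

namespace Literature.Computability.AlgebraicComplexity

/-! ## `T_{cw,q}` is `1_A`-generic: `T_{cw,q}(a₀^* + a₁^*)` is invertible -/

section CwGeneric

universe u

variable (K : Type u) [Field K]

/-- The covector `α = a₀^* + a₁^*` on `A = K^{q+1}`, used to witness `1_A`-genericity of `T_{cw,q}`:
`T_{cw,q}(α) = ∑_{j ≥ 1} b_j ⊗ c_j + b₀ ⊗ c₁ + b₁ ⊗ c₀` (CGLV 2022, proof of Cor. 3.5: "`T_2` is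
`1_A`-generic"). [cite: ConnerGesmundoLandsbergVentura2022, Cor. 3.5 (proof)] -/
def cwCovector (q : ℕ) : Fin (q + 1) → K := fun i => if (i : ℕ) ≤ 1 then 1 else 0

variable {K}

/-- `∑_i α_i f_i = f_0 + f_1` for `α = a₀^* + a₁^*`. [folklore] -/
theorem sum_cwCovector_mul {q : ℕ} (hq : 1 ≤ q) (f : Fin (q + 1) → K) :
    ∑ i, cwCovector K q i * f i = f ⟨0, by omega⟩ + f ⟨1, by omega⟩ := by
  rw [Fintype.sum_eq_add (⟨0, by omega⟩ : Fin (q + 1)) ⟨1, by omega⟩ (by simp)]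
  · simp [cwCovector]
  · rintro ⟨i, hi⟩ ⟨h0, h1⟩
    simp only [ne_eq, Fin.ext_iff] at h0 h1
    simp only [cwCovector, ite_mul, one_mul, zero_mul, ite_eq_right_iff]
    intro h; omega

/-- The slice `T_{cw,q}(a₀^*) = ∑_{j ≥ 1} b_j ⊗ c_j`. [cite: ConnerGesmundoLandsbergVentura2022, eq. (1)] -/
theorem cwTensor_slice_zero {q : ℕ} (b c : Fin (q + 1)) :
    cwTensor K q ⟨0, by omega⟩ b c = if c = b then (if (b : ℕ) = 0 then 0 else 1) else 0 := by
  rw [cwTensor_apply]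
  rcases b with ⟨b, hb⟩
  rcases c with ⟨c, hc⟩
  simp only [Fin.ext_iff, Fin.val_zero, ne_eq]
  split_ifs <;> simp_all

/-- The slice `T_{cw,q}(a₁^*) = b₀ ⊗ c₁ + b₁ ⊗ c₀` (`q ≥ 1`). [cite: ConnerGesmundoLandsbergVentura2022, eq. (1)] -/
theorem cwTensor_slice_one {q : ℕ} (hq : 1 ≤ q) (b c : Fin (q + 1)) :
    cwTensor K q ⟨1, by omega⟩ b c =
      (if c = ⟨1, by omega⟩ then (if (b : ℕ) = 0 then 1 else 0) else 0) +
        (if c = ⟨0, by omega⟩ then (if (b : ℕ) = 1 then 1 else 0) else 0) := by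
  rw [cwTensor_apply]
  rcases b with ⟨b, hb⟩
  rcases c with ⟨c, hc⟩
  simp only [Fin.ext_iff, Fin.val_zero, ne_eq]
  split_ifs <;> simp_all

/-- `T_{cw,q}(a₀^* + a₁^*) x` in coordinates: `(x₁, x₀ + x₁, x₂, …, x_q)`. [cite: ConnerGesmundoLandsbergVentura2022, Cor. 3.5 (proof)] -/
theorem contractFirst_cwCovector_mulVec {q : ℕ} (hq : 1 ≤ q) (x : Fin (q + 1) → K) (b : Fin (q + 1)) :
    (contractFirst (cwCovector K q) (cwTensor K q)).mulVec x b =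
      (if (b : ℕ) = 0 then 0 else x b) + (if (b : ℕ) = 0 then x ⟨1, by omega⟩ else 0) +
        (if (b : ℕ) = 1 then x ⟨0, by omega⟩ else 0) := by
  simp only [Matrix.mulVec, dotProduct, contractFirst_apply]
  simp_rw [sum_cwCovector_mul hq, cwTensor_slice_zero, cwTensor_slice_one hq]
  simp only [add_mul, Finset.sum_add_distrib, ite_mul, zero_mul, one_mul, Finset.sum_ite_eq',
    Finset.mem_univ, if_true]
  split_ifs <;> simp

/-- **`T_{cw,q}` is `1_A`-generic** (`q ≥ 1`): `T_{cw,q}(a₀^* + a₁^*)` is invertible.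
[cite: ConnerGesmundoLandsbergVentura2022, Cor. 3.5 (proof)] -/
theorem isUnit_contractFirst_cwCovector {q : ℕ} (hq : 1 ≤ q) :
    IsUnit (contractFirst (cwCovector K q) (cwTensor K q)) := by
  rw [← Matrix.mulVec_injective_iff_isUnit]
  set M := contractFirst (cwCovector K q) (cwTensor K q) with hM
  have hzero : ∀ z : Fin (q + 1) → K, M.mulVec z = 0 → z = 0 := by
    intro z hz
    have hrow : ∀ b : Fin (q + 1), (if (b : ℕ) = 0 then 0 else z b) +
        (if (b : ℕ) = 0 then z ⟨1, by omega⟩ else 0) + (if (b : ℕ) = 1 then z ⟨0, by omega⟩ else 0) = 0 := by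
      intro b
      rw [← contractFirst_cwCovector_mulVec hq z b, ← hM, hz, Pi.zero_apply]
    have h1 : z ⟨1, by omega⟩ = 0 := by simpa using hrow ⟨0, by omega⟩
    have h0 : z ⟨0, by omega⟩ = 0 := by
      have := hrow ⟨1, by omega⟩
      simpa [h1] using this
    funext b
    rcases b with ⟨b, hb⟩
    by_cases hb0 : b = 0
    · subst hb0; simpa using h0
    by_cases hb1 : b = 1
    · subst hb1; simpa using h1
    have := hrow ⟨b, hb⟩
    simpa [hb0, hb1] using this
  intro x y hxy
  have h : M.mulVec (x - y) = 0 := by rw [Matrix.mulVec_sub, hxy, sub_self]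
  exact sub_eq_zero.1 (hzero _ h)

/-- Hence every Kronecker power `T_{cw,q}^{⊠N}` (`q ≥ 1`) is `1_A`-generic (CGLV 2022, proof of
Cor. 3.5). [cite: ConnerGesmundoLandsbergVentura2022, Cor. 3.5 (proof)] -/
theorem isOneAGeneric_kroneckerPow_cwTensor {q : ℕ} (hq : 1 ≤ q) (N : ℕ) :
    IsOneAGeneric (kroneckerPow (cwTensor K q) N) :=
  isOneAGeneric_kroneckerPow (cwTensor K q) (isUnit_contractFirst_cwCovector hq) N

end CwGeneric

/-! ## The restriction `φ₃ : A^{⊗3} → ℂ⁵` of CGLV 2022, Thm. 3.4 (`φ₂` of Thm. 3.3 is `cglvPhi2` of `BorderRankCWKoszulRanks.lean`) -/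

section Restrictions

universe u

variable (K : Type u) [CommRing K]

/-- **The restriction `φ₃ : A^{⊗3} → A' = ⟨e₀, …, e₄⟩`** of CGLV 2022, proof of Thm. 3.4, as a
`5 × (q+1)³` matrix (column `a_{ijk} ↦ (i, j, k) = (x 0, x 1, x 2)`; row `s` = coefficient of
`α_{ijk}` in `φ₃ᵀ(e^s)`): `φ₃ᵀ(e⁰) = α₀₀₀`, `φ₃ᵀ(e¹) = ∑_{i=1}^q (α_{i00} + α_{0i0} + α_{00i})`,
`φ₃ᵀ(e²) = α₀₀₁ + α₀₁₀ + α₀₁₂ + α₁₀₂ + α₁₁₀ + α₁₂₁ + α₂₀₀ + α₂₁₁`,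
`φ₃ᵀ(e³) = α₀₂₂ + α₀₃₀ + α₀₃₁ + α₁₀₀ + α₁₀₃ - α₁₂₀ + α₂₁₀ + α₂₁₂ + α₃₀₀`,
`φ₃ᵀ(e⁴) = α₀₀₂ + α₀₀₄ + α₀₁₁ + α₀₁₄ + α₀₂₀ + α₀₂₃ + α₀₃₂ + α₀₄₀ + α₁₀₀ + α₁₂₂ + α₂₂₀ + α₃₀₃`.
[cite: ConnerGesmundoLandsbergVentura2022, Thm. 3.4 (proof)] -/
def cglvPhi3 (q : ℕ) : Matrix (Fin (2 * 2 + 1)) (Fin 3 → Fin (q + 1)) K :=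
  Matrix.of fun e x =>
    if (e : ℕ) = 0 then
      (if ((x 0 : ℕ), (x 1 : ℕ), (x 2 : ℕ)) = (0, 0, 0) then 1 else 0)
    else if (e : ℕ) = 1 then
      (if (1 ≤ (x 0 : ℕ) ∧ (x 1 : ℕ) = 0 ∧ (x 2 : ℕ) = 0) ∨ ((x 0 : ℕ) = 0 ∧ 1 ≤ (x 1 : ℕ) ∧ (x 2 : ℕ) = 0) ∨
          ((x 0 : ℕ) = 0 ∧ (x 1 : ℕ) = 0 ∧ 1 ≤ (x 2 : ℕ)) then 1 else 0)
    else if (e : ℕ) = 2 then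
      (if ((x 0 : ℕ), (x 1 : ℕ), (x 2 : ℕ)) ∈
          [(0, 0, 1), (0, 1, 0), (0, 1, 2), (1, 0, 2), (1, 1, 0), (1, 2, 1), (2, 0, 0), (2, 1, 1)] then 1 else 0)
    else if (e : ℕ) = 3 then
      (if ((x 0 : ℕ), (x 1 : ℕ), (x 2 : ℕ)) ∈
          [(0, 2, 2), (0, 3, 0), (0, 3, 1), (1, 0, 0), (1, 0, 3), (2, 1, 0), (2, 1, 2), (3, 0, 0)] then 1 else 0) -
        (if ((x 0 : ℕ), (x 1 : ℕ), (x 2 : ℕ)) = (1, 2, 0) then 1 else 0)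
    else
      (if ((x 0 : ℕ), (x 1 : ℕ), (x 2 : ℕ)) ∈
          [(0, 0, 2), (0, 0, 4), (0, 1, 1), (0, 1, 4), (0, 2, 0), (0, 2, 3), (0, 3, 2), (0, 4, 0), (1, 0, 0),
            (1, 2, 2), (2, 2, 0), (3, 0, 3)] then 1 else 0)

end Restrictions

/-! ## Named facts: the Koszul-flattening ranks computed in CGLV 2022, §3, and the assembly of Thm. 1.2 (iii) -/

section RankFacts

/-- **CGLV 2022, Thm. 3.3 (proof), base case `q = 4`** ("When `q = 4` one does a direct
computation with the `p = 1` Koszul flattening, which is left to the reader, and which provides the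
base of the induction"): `rank((φ₂ T_{cw,4}^{⊠2})^{∧1}_{A'}) = 2 · 6² = 72` (confirmed numerically
when vendoring).  This finite instance is all that Cor. 3.5 and Thm. 1.2 (iii) use for `q = 4`.
[cite: ConnerGesmundoLandsbergVentura2022, Thm. 3.3 (proof, case q = 4)] -/
def CGLV2022_thm33_koszulRank_q4 : Prop :=
  (koszulFlattening 1 (cglvPhi2 ℂ 4).mulVecLin (kroneckerPow (cwTensor ℂ 4) 2)).rank = 72

/-- The base case is an instance of the general rank statement. [cite: ConnerGesmundoLandsbergVentura2022, Thm. 3.3 (proof)] -/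
theorem CGLV2022_thm33_koszulRank.q4 (h : CGLV2022_thm33_koszulRank) :
    CGLV2022_thm33_koszulRank_q4 := by
  have h4 := h 4 le_rfl
  norm_num at h4
  exact h4

/-- **CGLV 2022, Thm. 3.4 (proof), the rank computation**: for `q ≥ 5`, the `p = 2` Koszul
flattening of `T_q = φ₃(T_{cw,q}^{⊠3}) ∈ A' ⊗ B^{⊗3} ⊗ C^{⊗3}`, `A' = ℂ⁵`, has
`rank((T_q)^{∧2}_{A'}) = 6(q+2)³` ("We will show `rank((T_q)^{∧2}_{A'}) = 6(q+2)^3`, which implies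
`bR(T_{cw,q}^{⊠3}) ≥ (q+2)^3`"; proved in the source by an `𝔖_{q-4}^{×3}`-isotypic decomposition
and a computer calculation, §6).
[cite: ConnerGesmundoLandsbergVentura2022, Thm. 3.4 (proof)] -/
def CGLV2022_thm34_koszulRank : Prop :=
  ∀ q : ℕ, 5 ≤ q →
    (koszulFlattening 2 (cglvPhi3 ℂ q).mulVecLin (kroneckerPow (cwTensor ℂ q) 3)).rank =
      6 * (q + 2) ^ 3

/-- **CGLV 2022, Thm. 1.2 (iii), clause `q = 2`** (printed: "if `q = 2` then
`bR(T_{cw,2}^{⊠3}) ≥ 15 · 3^{N-2}`", read with `⊠N` for the evident typo `⊠3`; here `N ≥ 2`):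
`bR(T_{cw,2}^{⊠N}) ≥ 15 · 3^{N-2}`.  CAVEAT: the source proves Thm. 1.2 (iii) through Cor. 3.5,
which covers `q ≥ 4` only; for `q = 2` its Prop. 3.2 route would need a `p = 2` flattening of
`T_{cw,2}^{⊠2}` of rank `90`, whereas the maximal rank is `85` (`⌈85/6⌉ = 15`, cf.
ConnerHuangLandsberg2020 for `bR(T_{cw,2}^{⊠2}) = 16`).  The cases `N ≤ 5` hold by direct `p = 2`
flattenings of `T_{cw,2}^{⊠N}` (ranks `10·3^N - 5`, checked numerically when vendoring); no proof
of the general clause is known to the vendor.  Kept as printed because `CGLV2022_thm12_power` contains it.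
[cite: ConnerGesmundoLandsbergVentura2022, Thm. 1.2 (iii)] -/
def CGLV2022_thm12_power_q2 : Prop :=
  ∀ N : ℕ, 2 ≤ N → 15 * 3 ^ (N - 2) ≤ algBorderRank (kroneckerPow (cwTensor ℂ 2) N)

/-- **CGLV 2022, Cor. 3.5** (as printed; `N ≥ 3`, resp. `N ≥ 2`, so that the truncated exponents are
the printed ones): "For all `q > 4` and all `N`, `bR(T_{cw,q}^{⊠N}) ≥ (q+1)^{N-3}(q+2)^3`, and
`bR(T_{cw,4}^{⊠N}) ≥ 36 × 5^{N-2}`."  This is the part of Thm. 1.2 (iii) that the source proves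
(Prop. 3.2 + Thms. 3.3, 3.4). [cite: ConnerGesmundoLandsbergVentura2022, Cor. 3.5] -/
def CGLV2022_cor35 : Prop :=
  (∀ q N : ℕ, 4 < q → 3 ≤ N →
      (q + 1) ^ (N - 3) * (q + 2) ^ 3 ≤ algBorderRank (kroneckerPow (cwTensor ℂ q) N)) ∧
    (∀ N : ℕ, 2 ≤ N → 36 * 5 ^ (N - 2) ≤ algBorderRank (kroneckerPow (cwTensor ℂ 4) N))

/-- Thm. 1.2 (iii) for `q ≥ 5` from the cube flattening rank (CGLV, proof of Cor. 3.5: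
`T₁ = T_{cw,q}^{⊠3}`, `T₂ = T_{cw,q}^{⊠(N-3)}`, Prop. 3.2). [cite: ConnerGesmundoLandsbergVentura2022, Cor. 3.5 (proof)] -/
theorem CGLV2022_thm12_power_ge5_of_koszulRank (h34 : CGLV2022_thm34_koszulRank) (q N : ℕ)
    (hq : 4 < q) (hN : 3 ≤ N) :
    (q + 1) ^ (N - 3) * (q + 2) ^ 3 ≤ algBorderRank (kroneckerPow (cwTensor ℂ q) N) := by
  have hα := isUnit_contractFirst_cwCovector (K := ℂ) (q := q) (by omega)
  have key := rank_koszulFlattening_mul_pow_le_algBorderRank_kroneckerPow (cwTensor ℂ q) hα 2 3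
    (N - 3) N (by omega) (cglvPhi3 ℂ q).mulVecLin
  rw [h34 q (by omega), Fintype.card_fin, show Nat.choose (2 * 2) 2 = 6 by decide] at key
  have e : 6 * ((q + 1) ^ (N - 3) * (q + 2) ^ 3) = 6 * (q + 2) ^ 3 * (q + 1) ^ (N - 3) := by ring
  exact Nat.le_of_mul_le_mul_left (e ▸ key) (by norm_num)

/-- Thm. 1.2 (iii) for `q = 4` from the square flattening rank (CGLV, proof of Cor. 3.5:
`T₁ = T_{cw,4}^{⊠2}`, `T₂ = T_{cw,4}^{⊠(N-2)}`). [cite: ConnerGesmundoLandsbergVentura2022, Cor. 3.5 (proof)] -/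
theorem CGLV2022_thm12_power_four_of_koszulRank (h4 : CGLV2022_thm33_koszulRank_q4) (N : ℕ)
    (hN : 2 ≤ N) : 36 * 5 ^ (N - 2) ≤ algBorderRank (kroneckerPow (cwTensor ℂ 4) N) := by
  have hα := isUnit_contractFirst_cwCovector (K := ℂ) (q := 4) (by omega)
  have key := rank_koszulFlattening_mul_pow_le_algBorderRank_kroneckerPow (cwTensor ℂ 4) hα 1 2
    (N - 2) N (by omega) (cglvPhi2 ℂ 4).mulVecLin
  rw [h4, Fintype.card_fin, show Nat.choose (2 * 1) 1 = 2 by decide] at key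
  have e : 2 * (36 * 5 ^ (N - 2)) = 72 * (4 + 1) ^ (N - 2) := by norm_num; ring
  exact Nat.le_of_mul_le_mul_left (e ▸ key) (by norm_num)

/-- Thm. 1.2 (iii) for `q = 3` from the rank-`≥ 150` flattening of the square (Prop. 3.2 with
`T₁ = T_{cw,3}^{⊠2}`, `T₂ = T_{cw,3}^{⊠(N-2)}`). [cite: ConnerGesmundoLandsbergVentura2022, Thm. 1.2 (iii)] -/
theorem CGLV2022_thm12_power_three_of_koszulRank (h3 : CGLV2022_koszulRank_sq_three) (N : ℕ)
    (hN : 2 ≤ N) : 25 * 4 ^ (N - 2) ≤ algBorderRank (kroneckerPow (cwTensor ℂ 3) N) := by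
  have hα := isUnit_contractFirst_cwCovector (K := ℂ) (q := 3) (by omega)
  have key := rank_koszulFlattening_mul_pow_le_algBorderRank_kroneckerPow (cwTensor ℂ 3) hα 2 2
    (N - 2) N (by omega) (cglvPhiSq3 ℂ).mulVecLin
  rw [Fintype.card_fin, show Nat.choose (2 * 2) 2 = 6 by decide] at key
  have key' := (Nat.mul_le_mul_right ((3 + 1) ^ (N - 2)) h3).trans key
  have e : 6 * (25 * 4 ^ (N - 2)) = 150 * (3 + 1) ^ (N - 2) := by norm_num; ring
  exact Nat.le_of_mul_le_mul_left (e ▸ key') (by norm_num)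

/-- **Cor. 3.5 from the flattening ranks of Thms. 3.3–3.4** (the source's proof of Cor. 3.5).
[cite: ConnerGesmundoLandsbergVentura2022, Cor. 3.5 (proof)] -/
theorem CGLV2022_cor35_of_koszulRank (h4 : CGLV2022_thm33_koszulRank_q4)
    (h34 : CGLV2022_thm34_koszulRank) : CGLV2022_cor35 :=
  ⟨fun q N hq hN => CGLV2022_thm12_power_ge5_of_koszulRank h34 q N hq hN,
    fun N hN => CGLV2022_thm12_power_four_of_koszulRank h4 N hN⟩

/-- **Thm. 1.2 (iii) (`CGLV2022_thm12_power`) from its ingredients**: the cube flattening rank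
(Thm. 3.4, `q ≥ 5`), the square flattening ranks (Thm. 3.3 base case `q = 4`, and the rank `≥ 150` for
`q = 3` of `BorderRankCWKoszulRanks.CGLV2022_koszulRank_sq_three`), and the clause `q = 2`. [cite: ConnerGesmundoLandsbergVentura2022, Thm. 1.2 (iii)] -/
theorem CGLV2022_thm12_power_of_koszulRank (h34 : CGLV2022_thm34_koszulRank)
    (h4 : CGLV2022_thm33_koszulRank_q4) (h3 : CGLV2022_koszulRank_sq_three)
    (h2 : CGLV2022_thm12_power_q2) : CGLV2022_thm12_power := by
  refine ⟨fun q N hq hN => CGLV2022_thm12_power_ge5_of_koszulRank h34 q N hq hN, ?_, h2⟩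
  rintro q N (rfl | rfl) hN
  · simpa using CGLV2022_thm12_power_three_of_koszulRank h3 N hN
  · simpa using CGLV2022_thm12_power_four_of_koszulRank h4 N hN

/-- Conversely `CGLV2022_thm12_power` contains Cor. 3.5 and the `q = 2` clause.
[cite: ConnerGesmundoLandsbergVentura2022, Thm. 1.2 (iii)] -/
theorem CGLV2022_thm12_power.cor35 (h : CGLV2022_thm12_power) : CGLV2022_cor35 :=
  ⟨h.1, fun N hN => by simpa using h.2.1 4 N (Or.inr rfl) hN⟩

/-- The `q = 2` clause of `CGLV2022_thm12_power`. [cite: ConnerGesmundoLandsbergVentura2022, Thm. 1.2 (iii)] -/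
theorem CGLV2022_thm12_power.q2 (h : CGLV2022_thm12_power) : CGLV2022_thm12_power_q2 := h.2.2

end RankFacts

end Literature.Computability.AlgebraicComplexity
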